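import Mathlib
import Summits.Ventures.HodgeRepro.Tier4.Line4.LinRegularLocal

/-!
# Tier4/Line4/LinRegularLocalElem — C-L4-LINREG-LOCAL, element form: the `S`-part of a local stabiliser is central

Blind re-derivation cell `pub-hodge-repro`, Tier 4 «prove the step» (README §9–§10), seat t4-L1-p1 (prover, LINE L1
lineage on the L4 chair, gen 5; the ELEMENT form announced in S15551/S15582/S15628 (3), re-typed for the SET form of
PSPLIT (L2-p1 S15638: the split of record is along `S := placesAbove k p`, not one place)).  Tree path
`lean/Summits/Ventures/HodgeRepro/Tier4/Line4/LinRegularLocalElem.lean`.  Mathlib-level; no literature.  Imports only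
the LANDED `Line4.LinRegularLocal` (p709456): every statement is phrased through the components
`GA.finiteComponent` / `GA.infiniteComponent`, so that L2-p1's `GA.ofPlacesPart W S` (PlacePart, not yet landed) plugs
in by its component laws `finiteComponent_ofPlacesPart_of_mem / _of_notMem` + `ofPlacesPart_mem_finitePart` in two lines.

WHAT IS PROVED (every declaration sorry-free, axioms `[propext, Classical.choice, Quot.sound]`).
* `adMatAt_mul`, `scalar_mul_comm_of_comm_Ω` — `x • 1 + z • Ω_v` commutes with every local matrix commuting with `Ω_v`.
* `ext_of_components_on S` — two elements supported on `S` (finite components `1` off `S`, archimedean components `1`)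
  with the same components on `S` are equal.
* **`mem_centre_of_components_on S (hg) (hinf) (hsc : ∀ w ∈ S, ∃ x z, ↑(g_w) = x • 1 + z • Ω_w) : g ∈ centre W`** —
  an element supported on `S` whose components on `S` are `E′_w`-scalars lies in the centre
  `Z = T ⊓ T′ ⊓ center` (componentwise: at `w ∈ S` the scalar commutes with `P i`, `Q i` and with every `h_w`;
  elsewhere `1`).
* **`mem_centre_of_stab_on (hlin : IsLinRegular W γ₀) S (ht) (ht') (h : ∀ v ∈ S, t_v⁻¹ γ₀,v t'_v = γ₀,v)
  (hg) (hinf) (hgS : ∀ w ∈ S, g_w = t_w) : g ∈ centre W`** and **`eq_of_stab_on … (hg') (hg'S : ∀ w ∈ S, g'_w = t'_w) :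
  g' = g`** — the element form of `finiteComponent_eq_scalar_of_stab_at` (LinRegularLocal p709456): ANY element `g`
  supported on `S` carrying the `S`-components of a torus pair satisfying the stabiliser equation at every `v ∈ S` is
  central, and the element carrying `t'`'s `S`-components is the same element («`t_S ∈ Z`, `t′_S = t_S`» as elements of
  `G(𝔸_k)`, ready for `RTFData.chi_centre`; instantiate `g := GA.ofPlacesPart W S t`, `g' := GA.ofPlacesPart W S t'`).
* Singleton forms on `atFinitePlace W v`: `ext_of_mem_atFinitePlace`, `mem_centre_of_mem_atFinitePlace`.

Nothing here says anything about the status of the Hodge conjecture for CM abelian varieties, which is NOT proved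
(HC_CM is NOT proved by anyone in this repository).
-/

set_option autoImplicit false
noncomputable section
namespace Summit.Ventures.HodgeRepro.Tier4.Line4
open Summit.Ventures.HodgeRepro.Tier4 Summit.Ventures.HodgeRepro.Tier4.Common Summit.Ventures.HodgeRepro.Tier4.Line1
  NumberField IsDedekindDomain Matrix

section LinRegularLocalElem

variable {k : Type} [Field k] [NumberField k] (W : PlaneData k)

/-- `adMatAt` is multiplicative. -/
theorem adMatAt_mul (v : HeightOneSpectrum (𝓞 k)) (A B : Matrix (Fin 4) (Fin 4) k) :
    adMatAt k v (A * B) = adMatAt k v A * adMatAt k v B :=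
  Matrix.map_mul

/-- **an `E′_v`-scalar commutes with everything commuting with `Ω_v`.** -/
theorem scalar_mul_comm_of_comm_Ω (v : HeightOneSpectrum (𝓞 k)) (x z : v.adicCompletion k)
    {A : Matrix (Fin 4) (Fin 4) (v.adicCompletion k)} (hA : A * adMatAt k v W.Ω = adMatAt k v W.Ω * A) :
    (x • (1 : Matrix (Fin 4) (Fin 4) (v.adicCompletion k)) + z • adMatAt k v W.Ω) * A =
      A * (x • (1 : Matrix (Fin 4) (Fin 4) (v.adicCompletion k)) + z • adMatAt k v W.Ω) := by
  rw [add_mul, mul_add, smul_mul_assoc, smul_mul_assoc, mul_smul_comm, mul_smul_comm, one_mul, mul_one, hA]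

/-- the `v`-component of `adMat A` commutes with `Ω_v` when `A` commutes with `Ω`. -/
theorem adMatAt_comm_Ω_of_comm (v : HeightOneSpectrum (𝓞 k)) {A : Matrix (Fin 4) (Fin 4) k} (h : A * W.Ω = W.Ω * A) :
    adMatAt k v A * adMatAt k v W.Ω = adMatAt k v W.Ω * adMatAt k v A := by
  rw [← adMatAt_mul, ← adMatAt_mul, h]

variable (S : Set (HeightOneSpectrum (𝓞 k)))

/-- **two elements supported on `S` with the same components on `S` are equal.** -/
theorem ext_of_components_on {g g' : GA W}
    (hg : ∀ w, w ∉ S → GA.finiteComponent W w g = 1) (hg' : ∀ w, w ∉ S → GA.finiteComponent W w g' = 1)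
    (hinf : ∀ w : InfinitePlace k, GA.infiniteComponent W w g = 1)
    (hinf' : ∀ w : InfinitePlace k, GA.infiniteComponent W w g' = 1)
    (h : ∀ w, w ∈ S → GA.finiteComponent W w g = GA.finiteComponent W w g') : g = g' := by
  apply GA.ext_of_components
  · intro w
    rw [hinf w, hinf' w]
  · intro w
    by_cases hw : w ∈ S
    · exact h w hw
    · rw [hg w hw, hg' w hw]

/-- an element supported on `S` whose components on `S` commute with `A_w` lies in the commutant of `A`. -/
theorem mem_commutant_of_components_on {g : GA W}
    (hg : ∀ w, w ∉ S → GA.finiteComponent W w g = 1)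
    (hinf : ∀ w : InfinitePlace k, GA.infiniteComponent W w g = 1)
    {A : Matrix (Fin 4) (Fin 4) k}
    (hA : ∀ w, w ∈ S →
      ((GA.finiteComponent W w g : GL (Fin 4) (w.adicCompletion k)) : Matrix (Fin 4) (Fin 4) (w.adicCompletion k)) *
          adMatAt k w A =
        adMatAt k w A *
          ((GA.finiteComponent W w g : GL (Fin 4) (w.adicCompletion k)) : Matrix (Fin 4) (Fin 4) (w.adicCompletion k))) :
    g ∈ commutant W A := by
  show GA.mat W g * adMat k A = adMat k A * GA.mat W g
  apply M4_ext_of_components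
  · intro w
    rw [compInf_mul, compInf_mul, compInf_mat, hinf w, Units.val_one, one_mul, mul_one]
  · intro w
    by_cases hw : w ∈ S
    · rw [compFin_mul, compFin_mul, compFin_mat, compFin_adMat_eq_adMatAt]
      exact hA w hw
    · rw [compFin_mul, compFin_mul, compFin_mat, hg w hw, Units.val_one, one_mul, mul_one]

/-- an element supported on `S` whose components on `S` commute with every `h_w` is central in `G(𝔸_k)`. -/
theorem mem_center_of_components_on {g : GA W}
    (hg : ∀ w, w ∉ S → GA.finiteComponent W w g = 1)
    (hinf : ∀ w : InfinitePlace k, GA.infiniteComponent W w g = 1)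
    (hc : ∀ w, w ∈ S → ∀ h : GA W, GA.finiteComponent W w g * GA.finiteComponent W w h =
      GA.finiteComponent W w h * GA.finiteComponent W w g) : g ∈ Subgroup.center (GA W) := by
  rw [Subgroup.mem_center_iff]
  intro h
  apply GA.ext_of_components
  · intro w
    rw [map_mul, map_mul, hinf w, one_mul, mul_one]
  · intro w
    by_cases hw : w ∈ S
    · rw [map_mul, map_mul]
      exact (hc w hw h).symm
    · rw [map_mul, map_mul, hg w hw, one_mul, mul_one]

/-- **an element supported on `S` whose components on `S` are `E′_w`-scalars lies in the centre `Z`.** -/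
theorem mem_centre_of_components_on {g : GA W}
    (hg : ∀ w, w ∉ S → GA.finiteComponent W w g = 1)
    (hinf : ∀ w : InfinitePlace k, GA.infiniteComponent W w g = 1)
    (hsc : ∀ w, w ∈ S → ∃ x z : w.adicCompletion k,
      ((GA.finiteComponent W w g : GL (Fin 4) (w.adicCompletion k)) : Matrix (Fin 4) (Fin 4) (w.adicCompletion k)) =
        x • (1 : Matrix (Fin 4) (Fin 4) (w.adicCompletion k)) + z • adMatAt k w W.Ω) :
    g ∈ centre W := by
  have key : ∀ w, w ∈ S → ∀ {B : Matrix (Fin 4) (Fin 4) k}, B * W.Ω = W.Ω * B →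
      ((GA.finiteComponent W w g : GL (Fin 4) (w.adicCompletion k)) : Matrix (Fin 4) (Fin 4) (w.adicCompletion k)) *
          adMatAt k w B =
        adMatAt k w B *
          ((GA.finiteComponent W w g : GL (Fin 4) (w.adicCompletion k)) :
            Matrix (Fin 4) (Fin 4) (w.adicCompletion k)) := by
    intro w hw B hB
    obtain ⟨x, z, hxz⟩ := hsc w hw
    rw [hxz]
    exact scalar_mul_comm_of_comm_Ω W w x z (adMatAt_comm_Ω_of_comm W w hB)
  refine ⟨⟨?_, ?_⟩, ?_⟩
  · exact ⟨mem_commutant_of_components_on W S hg hinf fun w hw => key w hw (W.P_comm 0),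
      mem_commutant_of_components_on W S hg hinf fun w hw => key w hw (W.P_comm 1)⟩
  · exact ⟨mem_commutant_of_components_on W S hg hinf fun w hw => key w hw (W.Q_comm 0),
      mem_commutant_of_components_on W S hg hinf fun w hw => key w hw (W.Q_comm 1)⟩
  · refine mem_center_of_components_on W S hg hinf fun w hw h => ?_
    obtain ⟨x, z, hxz⟩ := hsc w hw
    apply Units.ext
    rw [Units.val_mul, Units.val_mul, hxz]
    exact scalar_mul_comm_of_comm_Ω W w x z (finiteComponent_comm_Ω W w h)

/-- **C-L4-LINREG-LOCAL, element form (centrality)**: any element `g` supported on `S` whose components on `S` are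
those of a torus element `t ∈ T` satisfying, with some `t' ∈ T′`, the stabiliser equation at every `v ∈ S`, is central
(`t_S ∈ Z` as an element of `G(𝔸_k)`; `finiteComponent_eq_scalar_of_stab_at` of LinRegularLocal p709456 at each
`v ∈ S`). -/
theorem mem_centre_of_stab_on {γ₀ : rationalPoints W} (hlin : IsLinRegular W γ₀)
    {t t' : GA W} (ht : t ∈ torusT W) (ht' : t' ∈ torusT' W)
    (h : ∀ v, v ∈ S → (GA.finiteComponent W v t)⁻¹ * GA.finiteComponent W v (γ₀ : GA W) *
      GA.finiteComponent W v t' = GA.finiteComponent W v (γ₀ : GA W))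
    {g : GA W} (hg : ∀ w, w ∉ S → GA.finiteComponent W w g = 1)
    (hinf : ∀ w : InfinitePlace k, GA.infiniteComponent W w g = 1)
    (hgS : ∀ w, w ∈ S → GA.finiteComponent W w g = GA.finiteComponent W w t) :
    g ∈ centre W := by
  refine mem_centre_of_components_on W S hg hinf fun w hw => ?_
  rw [hgS w hw]
  exact (finiteComponent_eq_scalar_of_stab_at W hlin w ht ht' (h w hw)).1

/-- **C-L4-LINREG-LOCAL, element form (equality)**: under the stabiliser equation at every `v ∈ S`, the element
supported on `S` carrying `t'`'s components on `S` equals the one carrying `t`'s (`t′_S = t_S` in `G(𝔸_k)`). -/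
theorem eq_of_stab_on {γ₀ : rationalPoints W} (hlin : IsLinRegular W γ₀)
    {t t' : GA W} (ht : t ∈ torusT W) (ht' : t' ∈ torusT' W)
    (h : ∀ v, v ∈ S → (GA.finiteComponent W v t)⁻¹ * GA.finiteComponent W v (γ₀ : GA W) *
      GA.finiteComponent W v t' = GA.finiteComponent W v (γ₀ : GA W))
    {g g' : GA W} (hg : ∀ w, w ∉ S → GA.finiteComponent W w g = 1)
    (hg' : ∀ w, w ∉ S → GA.finiteComponent W w g' = 1)
    (hinf : ∀ w : InfinitePlace k, GA.infiniteComponent W w g = 1)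
    (hinf' : ∀ w : InfinitePlace k, GA.infiniteComponent W w g' = 1)
    (hgS : ∀ w, w ∈ S → GA.finiteComponent W w g = GA.finiteComponent W w t)
    (hg'S : ∀ w, w ∈ S → GA.finiteComponent W w g' = GA.finiteComponent W w t') :
    g' = g := by
  refine ext_of_components_on W S hg' hg hinf' hinf fun w hw => ?_
  rw [hgS w hw, hg'S w hw]
  exact (finiteComponent_eq_scalar_of_stab_at W hlin w ht ht' (h w hw)).2

/-- **two elements supported at `v` with the same `v`-component are equal.** -/
theorem ext_of_mem_atFinitePlace (v : HeightOneSpectrum (𝓞 k)) {g g' : GA W} (hg : g ∈ atFinitePlace W v)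
    (hg' : g' ∈ atFinitePlace W v) (h : GA.finiteComponent W v g = GA.finiteComponent W v g') : g = g' :=
  ext_of_components_on W {v} (fun w hw => hg.1 w hw) (fun w hw => hg'.1 w hw) hg.2 hg'.2
    (fun w hw => by rw [Set.mem_singleton_iff.mp hw]; exact h)

/-- **an element supported at `v` whose `v`-component is an `E′_v`-scalar lies in the centre `Z`.** -/
theorem mem_centre_of_mem_atFinitePlace (v : HeightOneSpectrum (𝓞 k)) {g : GA W} (hg : g ∈ atFinitePlace W v)
    (hsc : ∃ x z : v.adicCompletion k,
      ((GA.finiteComponent W v g : GL (Fin 4) (v.adicCompletion k)) : Matrix (Fin 4) (Fin 4) (v.adicCompletion k)) =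
        x • (1 : Matrix (Fin 4) (Fin 4) (v.adicCompletion k)) + z • adMatAt k v W.Ω) :
    g ∈ centre W :=
  mem_centre_of_components_on W {v} (fun w hw => hg.1 w hw) hg.2
    (fun w hw => by rw [Set.mem_singleton_iff.mp hw]; exact hsc)

end LinRegularLocalElem

end Summit.Ventures.HodgeRepro.Tier4.Line4

end
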